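import Summits.MatrixMultiplication.MatrixMultiplication.Theorems.SoloInformedTwistedMatchingsAugCoords
import Summits.MatrixMultiplication.MatrixMultiplication.Theorems.SoloInformedTwistedMatchingsEffective
import Summits.MatrixMultiplication.MatrixMultiplication.Theorems.SoloInformedTwistedMatchingsCoprime
import Mathlib.Analysis.SpecialFunctions.Pow.NNReal
import HarnessLib

/-!
# Theorem B‴: twisting costs nothing — the binomial (BCCGNSU) count for every abelian `p`-group

Solo-informed seat (MatrixMultiplication), gen 102; sharpest-statement §2y(8), successor B‴ of
Theorem B″. With the augmentation coordinates of `SoloInformedTwistedMatchingsAugCoords`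
(monomials `∏ (x_i - 1)^{k_i}` of `K[∏_i ℤ/n_i]`, `n_i = p^{e_i}`, plain degree `Σ k_i`, filtered
for EVERY group endomorphism) the twisted slice-rank method gives, for a finite group
`S ≅ (∏_i ℤ/n_i) × T` with `p ∤ |T|`, ANY finite family of automorphism pairs `(φ_s, ψ_s)` of `S`
and any twisted matching `(∃ s, x_i φ_s(y_j) ψ_s(z_l) = 1) ⟺ i = j = l`:

* `binomialCoprime_twistedMatching_card_le` / `binomial_twistedMatching_card_le` (`T = 1`):
  `|ι| ≤ (#{k : Σ k_i < a} + #{k : Σ k_i < b} + #{k : Σ k_i ≥ a + b}) · |T|` over exponent vectors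
  `0 ≤ k_i < n_i` — for `T = 1` EXACTLY the tricolored-sum-free bound of
  Blasiak–Church–Cohn–Grochow–Naslund–Sawin–Umans 2017, Thm. 4.14, for the untwisted group
  `∏ ℤ/n_i`: the multiplier group of a translation scheme buys nothing, for every abelian
  `p`-group (Theorem B″ had this only for elementary abelian hosts; for exponent `p^E`, `E ≥ 2`,
  its count was the coarser level-weighted one);
* `binomialCoprime_twistedMatching_card_le_effective` / `binomial_twistedMatching_card_le_effective`:
  `|ι| ≤ 3 |T| ∏_i θ_{n_i}(u)`, `θ_q(u) = u^{-(q-1)/3} Σ_{j<q} u^j`, every `0 < u ≤ 1`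
  (`inf_u θ_q(u)` is the BCCGNSU/Petrov constant of `ℤ/q`: `θ_4 → 3.611 = 4^{0.926}`,
  `θ_8 → 7.00 = 8^{0.936}`, `θ_9 → 7.85 = 9^{0.938}`);
* `binomial_twistedMatching_card_le_rpow` (and `binomialCoprime_…_rpow`): if `θ_{n_i}(u) ≤ n_i^c`
  for all `i` then `|ι| ≤ 3 |S|^c` (resp. `3 |T| |A|^c`).

The abstract engine is `card_le_of_filteredCoprimeTwistedMatching`: graded coordinates of `K[A]`
filtered for every endomorphism of `A`, times the trivial grading of `K[T]`, `gcd(|A|,|T|) = 1`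
(endomorphisms of `A × T` are then diagonal).
References: BlasiakChurchCohnGrochowNaslundSawinUmans2017 (arXiv:1605.06702) Thm. 4.14, Prop. 4.15;
BlasiakChurchCohnGrochowUmans2017 (arXiv:1712.02302) Prop. 3.2/3.10; EllenbergGijswijt2017;
Petrov 2016 (arXiv:1606.02062); CohnUmans2013 (arXiv:1207.6528) §5; Tao's slice-rank note (2016).
-/

noncomputable section

open scoped BigOperators
open Finset Literature.Combinatorics.Additive Literature.Barriers.MatrixMultiplication

namespace Summit.MatrixMultiplication.MatrixMultiplication.Theorems.TwistedSliceRank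

section FilteredCoprime

variable {K : Type*} [Field K] {A : Type*} [Group A] [Fintype A] [DecidableEq A]
  {Λ : Type*} [Fintype Λ] [DecidableEq Λ] {T : Type*} [Group T] [Fintype T] [DecidableEq T]

/-- **Twisted matchings in `A × T` from fully filtered coordinates on `A`.** If graded coordinates
of `K[A]` are filtered for EVERY endomorphism of `A`, `x^{a₀} = 1` on `A`, `y^{t₀} = 1` on `T` and
`gcd(a₀, t₀) = 1`, then a weighted twisted matching in `A × T` under any finite family of
automorphism-pair twists has at most `(#{deg < a} + #{deg < b} + #{deg ≥ a+b}) · |T|` elements.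
[this work] -/
theorem card_le_of_filteredCoprimeTwistedMatching (B₁ : GradedCoords K A Λ)
    (hfilt : ∀ (φ : A →* A) (j' j : Λ), B₁.deg j < B₁.deg j' →
      ∑ x', B₁.P j' x' * B₁.Q (φ x') j = 0)
    {a₀ t₀ : ℕ} (hA : ∀ u : A, u ^ a₀ = 1) (hT : ∀ v : T, v ^ t₀ = 1) (hcop : Nat.Coprime a₀ t₀)
    {σ : Type*} [Fintype σ] (t : σ → K) (φ ψ : σ → (A × T) ≃* (A × T)) {ι' : Type*}
    [Fintype ι'] (x y z : ι' → A × T)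
    (hoff : ∀ (i j l : ι') (s : σ), x i * φ s (y j) * ψ s (z l) = 1 → i = j ∧ j = l)
    (hdiag : ∀ i : ι', (∑ s, t s * (if x i * φ s (y i) * ψ s (z i) = 1 then (1 : K) else 0)) ≠ 0)
    (a b : ℕ) :
    Fintype.card ι' ≤ (Fintype.card {e : Λ // B₁.deg e < a} +
      Fintype.card {e : Λ // B₁.deg e < b} +
      Fintype.card {e : Λ // a + b ≤ B₁.deg e}) * Fintype.card T := by
  classical
  -- any automorphism `θ` of `A × T` is diagonal with an endomorphism of `A` in the first slot,
  -- hence filtered for the product coordinates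
  have hfilt' : ∀ (θ : (A × T) ≃* (A × T)) (j' j : Λ × T),
      (B₁.prod (GradedCoords.trivial K T)).deg j < (B₁.prod (GradedCoords.trivial K T)).deg j' →
      ∑ x', (B₁.prod (GradedCoords.trivial K T)).P j' x' *
        (B₁.prod (GradedCoords.trivial K T)).Q (θ x') j = 0 := by
    intro θ j' j hlt
    refine prod_trivial_pushforward_filtered B₁ (fun g => θ g)
      (fun u => (θ (u, 1)).1) (fun v => (θ (1, v)).2)
      (fun g => monoidHom_prod_eq_of_coprime hA hT hcop θ.toMonoidHom g) j' j ?_ hlt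
    intro h1
    have := hfilt ((MonoidHom.fst A T).comp (θ.toMonoidHom.comp (MonoidHom.inl A T))) j'.1 j.1 h1
    simpa only [MonoidHom.coe_comp, Function.comp_apply, MonoidHom.coe_fst,
      MonoidHom.inl_apply, MulEquiv.toMonoidHom_eq_coe, MonoidHom.coe_coe] using this
  have h := card_le_of_twistedMatching (B₁.prod (GradedCoords.trivial K T)) t
    (fun s g => φ s g) (fun s g => ψ s g) ?_ ?_ x y z hoff hdiag a b
  · have e1 : Fintype.card {i : Λ × T // (B₁.prod (GradedCoords.trivial K T)).deg i < a} =
        Fintype.card {e : Λ // B₁.deg e < a} * Fintype.card T :=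
      GradedCoords.card_prod_trivial B₁ (· < a)
    have e2 : Fintype.card {i : Λ × T // (B₁.prod (GradedCoords.trivial K T)).deg i < b} =
        Fintype.card {e : Λ // B₁.deg e < b} * Fintype.card T :=
      GradedCoords.card_prod_trivial B₁ (· < b)
    have e3 : Fintype.card {i : Λ × T // a + b ≤ (B₁.prod (GradedCoords.trivial K T)).deg i} =
        Fintype.card {e : Λ // a + b ≤ B₁.deg e} * Fintype.card T :=
      GradedCoords.card_prod_trivial B₁ (a + b ≤ ·)
    rw [e1, e2, e3] at h
    simpa only [add_mul] using h
  · intro s j' j hlt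
    exact hfilt' (φ s) j' j hlt
  · intro s k k' hlt
    have h1 : ∀ g : A × T, (ψ s g⁻¹)⁻¹ = ψ s g := fun g => by rw [map_inv, inv_inv]
    simp_rw [h1]
    rw [show (∑ g, (B₁.prod (GradedCoords.trivial K T)).P k (ψ s g) *
        (B₁.prod (GradedCoords.trivial K T)).Q g k') =
        ∑ x', (B₁.prod (GradedCoords.trivial K T)).P k x' *
          (B₁.prod (GradedCoords.trivial K T)).Q ((ψ s).symm x') k' from
      Fintype.sum_equiv (ψ s).toEquiv _ _ (fun g => by simp)]
    exact hfilt' (ψ s).symm k k' hlt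

end FilteredCoprime

section Binomial

/-- Dependent generating function: `Σ_{k ∈ ∏ [0,n_i)} u^{c + ε Σ k_i} = u^c ∏_i Σ_{j<n_i} u^{ε j}`.
[folklore] -/
theorem sum_rpow_pi {κ : Type*} [Fintype κ] [DecidableEq κ] (n : κ → ℕ) (u : ℝ) (hu : 0 < u)
    (c ε : ℝ) :
    ∑ k : (i : κ) → Fin (n i), u ^ (c + ε * ∑ i, ((k i : ℕ) : ℝ)) =
      u ^ c * ∏ i, ∑ j : Fin (n i), u ^ (ε * ((j : ℕ) : ℝ)) := by
  have h1 : ∀ k : (i : κ) → Fin (n i), u ^ (c + ε * ∑ i, ((k i : ℕ) : ℝ)) =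
      u ^ c * ∏ i, u ^ (ε * ((k i : ℕ) : ℝ)) := by
    intro k
    rw [Real.rpow_add hu, Finset.mul_sum, Real.rpow_sum_of_pos hu]
  simp_rw [h1]
  rw [← Finset.mul_sum, Fintype.prod_sum]

/-- **Theorem B‴ (combinatorial form, coprime splitting).** `S ≅ (∏_i ℤ/p^{e_i}) × T`, `p ∤ |T|`,
any finite family of automorphism pairs, any twisted matching:
`|ι| ≤ (#{Σ k_i < a} + #{Σ k_i < b} + #{Σ k_i ≥ a+b}) · |T|` over `0 ≤ k_i < p^{e_i}`. [this work] -/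
theorem binomialCoprime_twistedMatching_card_le (p : ℕ) [hp : Fact p.Prime] {κ : Type}
    [Fintype κ] [DecidableEq κ] (n e : κ → ℕ) [∀ i, NeZero (n i)] (hn : ∀ i, n i = p ^ e i)
    (T : Type) [Group T] [Fintype T] [DecidableEq T] (hT : Nat.Coprime p (Fintype.card T))
    (S : Type) [Group S] (eS : S ≃* (((i : κ) → Multiplicative (ZMod (n i))) × T))
    (σ : Type) [Fintype σ] (φ ψ : σ → S ≃* S) (ι : Type) [Fintype ι] (x y z : ι → S)
    (hmatch : ∀ i j l : ι, (∃ s : σ, x i * φ s (y j) * ψ s (z l) = 1) ↔ (i = j ∧ j = l))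
    (a b : ℕ) :
    Fintype.card ι ≤ (Fintype.card {k : (i : κ) → Fin (n i) // ∑ i, (k i : ℕ) < a} +
      Fintype.card {k : (i : κ) → Fin (n i) // ∑ i, (k i : ℕ) < b} +
      Fintype.card {k : (i : κ) → Fin (n i) // a + b ≤ ∑ i, (k i : ℕ)}) * Fintype.card T := by
  classical
  -- the field and the coordinates
  have hinj : Function.Injective
      (algebraMap (Polynomial (ZMod p)) (FractionRing (Polynomial (ZMod p)))) :=
    IsFractionRing.injective (Polynomial (ZMod p)) (FractionRing (Polynomial (ZMod p)))
  haveI : CharP (FractionRing (Polynomial (ZMod p))) p := charP_of_injective_algebraMap hinj p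
  haveI : Infinite (FractionRing (Polynomial (ZMod p))) := Infinite.of_injective _ hinj
  obtain ⟨B, hdeg, hfilt⟩ := exists_augCoords p (FractionRing (Polynomial (ZMod p))) n e hn
  -- transport the matching along `eS`
  let φ' := fun s => (eS.symm.trans (φ s)).trans eS
  let ψ' := fun s => (eS.symm.trans (ψ s)).trans eS
  have hrel : ∀ (i j l : ι) (s : σ),
      eS (x i) * φ' s (eS (y j)) * ψ' s (eS (z l)) = 1 ↔ x i * φ s (y j) * ψ s (z l) = 1 := by
    intro i j l s
    simp only [φ', ψ', MulEquiv.trans_apply, MulEquiv.symm_apply_apply]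
    rw [← map_mul, ← map_mul, eS.map_eq_one_iff]
  have hmatch' : ∀ i j l : ι,
      (∃ s : σ, eS (x i) * φ' s (eS (y j)) * ψ' s (eS (z l)) = 1) ↔ (i = j ∧ j = l) := by
    intro i j l
    simp_rw [hrel]
    exact hmatch i j l
  -- the weights
  let Sol : ι → Finset σ := fun i => Finset.univ.filter fun s =>
    eS (x i) * φ' s (eS (y i)) * ψ' s (eS (z i)) = 1
  have hSol : ∀ i, (Sol i).Nonempty := fun i => by
    obtain ⟨s, hs⟩ := (hmatch' i i i).2 ⟨rfl, rfl⟩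
    exact ⟨s, by simp [Sol, hs]⟩
  obtain ⟨t, ht⟩ := exists_weights (K := FractionRing (Polynomial (ZMod p))) Sol hSol
  have hdiag : ∀ i, (∑ s, t s * (if eS (x i) * φ' s (eS (y i)) * ψ' s (eS (z i)) = 1
      then (1 : FractionRing (Polynomial (ZMod p))) else 0)) ≠ 0 := by
    intro i
    have hsum : (∑ s, t s * (if eS (x i) * φ' s (eS (y i)) * ψ' s (eS (z i)) = 1
        then (1 : FractionRing (Polynomial (ZMod p))) else 0)) = ∑ s ∈ Sol i, t s := by
      rw [Finset.sum_filter]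
      exact Finset.sum_congr rfl fun s _ => by split_ifs <;> simp
    rw [hsum]
    exact ht i
  -- exponents of the two factors are coprime
  have hG : ∀ w : (i : κ) → Multiplicative (ZMod (n i)),
      w ^ Fintype.card ((i : κ) → Multiplicative (ZMod (n i))) = 1 := fun w => pow_card_eq_one
  have hTT : ∀ v : T, v ^ Fintype.card T = 1 := fun v => pow_card_eq_one
  have hcardG : Fintype.card ((i : κ) → Multiplicative (ZMod (n i))) = p ^ (∑ i, e i) := by
    rw [Fintype.card_pi, ← Finset.prod_pow_eq_pow_sum]
    exact Finset.prod_congr rfl fun i _ => by rw [Fintype.card_multiplicative, ZMod.card, hn i]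
  have hcop : (Fintype.card ((i : κ) → Multiplicative (ZMod (n i)))).Coprime (Fintype.card T) := by
    rw [hcardG]
    exact Nat.Coprime.pow_left _ hT
  have h := card_le_of_filteredCoprimeTwistedMatching B hfilt hG hTT hcop t φ' ψ'
    (fun i => eS (x i)) (fun i => eS (y i)) (fun i => eS (z i))
    (fun i j l s h => (hmatch' i j l).1 ⟨s, h⟩) hdiag a b
  have e1 : ∀ c : ℕ, Fintype.card {k : (i : κ) → Fin (n i) // B.deg k < c} =
      Fintype.card {k : (i : κ) → Fin (n i) // ∑ i, (k i : ℕ) < c} := fun c =>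
    Fintype.card_congr (Equiv.subtypeEquivRight fun k => by rw [hdeg])
  have e2 : Fintype.card {k : (i : κ) → Fin (n i) // a + b ≤ B.deg k} =
      Fintype.card {k : (i : κ) → Fin (n i) // a + b ≤ ∑ i, (k i : ℕ)} :=
    Fintype.card_congr (Equiv.subtypeEquivRight fun k => by rw [hdeg])
  rw [e1, e1, e2] at h
  exact h

/-- **Theorem B‴ (combinatorial form): twisting costs nothing in `∏ ℤ/p^{e_i}`.** For
`S ≅ ∏_i ℤ/p^{e_i}`, any finite family of automorphism pairs `(φ_s, ψ_s)` of `S` and any family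
`(x_i, y_i, z_i)_{i ∈ ι}` with `(∃ s, x_i φ_s(y_j) ψ_s(z_l) = 1) ⟺ i = j = l`:
`|ι| ≤ #{Σ k_i < a} + #{Σ k_i < b} + #{Σ k_i ≥ a+b}` over exponent vectors `0 ≤ k_i < p^{e_i}` — the
Blasiak–Church–Cohn–Grochow–Naslund–Sawin–Umans bound for tricolored sum-free sets in the UNTWISTED
group (BCCGNSU 2017, Thm. 4.14), for every `a, b`. [this work] -/
theorem binomial_twistedMatching_card_le (p : ℕ) [Fact p.Prime] {κ : Type} [Fintype κ]
    [DecidableEq κ] (n e : κ → ℕ) [∀ i, NeZero (n i)] (hn : ∀ i, n i = p ^ e i)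
    (S : Type) [Group S] (eS : S ≃* ((i : κ) → Multiplicative (ZMod (n i))))
    (σ : Type) [Fintype σ] (φ ψ : σ → S ≃* S) (ι : Type) [Fintype ι] (x y z : ι → S)
    (hmatch : ∀ i j l : ι, (∃ s : σ, x i * φ s (y j) * ψ s (z l) = 1) ↔ (i = j ∧ j = l))
    (a b : ℕ) :
    Fintype.card ι ≤ Fintype.card {k : (i : κ) → Fin (n i) // ∑ i, (k i : ℕ) < a} +
      Fintype.card {k : (i : κ) → Fin (n i) // ∑ i, (k i : ℕ) < b} +
      Fintype.card {k : (i : κ) → Fin (n i) // a + b ≤ ∑ i, (k i : ℕ)} := by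
  have h := binomialCoprime_twistedMatching_card_le p n e hn Unit
    (by rw [Fintype.card_unit]; exact Nat.coprime_one_right p) S
    (eS.trans (MulEquiv.prodUnique : (((i : κ) → Multiplicative (ZMod (n i))) × Unit) ≃* _).symm)
    σ φ ψ ι x y z hmatch a b
  simpa only [Fintype.card_unit, mul_one] using h

/-- **Theorem B‴ (effective form, coprime splitting).** `S ≅ (∏_i ℤ/n_i) × T`, `n_i = p^{e_i}`,
`p ∤ |T|`, any automorphism-pair twists, any twisted matching, any `0 < u ≤ 1`:
`|ι| ≤ 3 · (∏_i u^{-(n_i-1)/3} Σ_{j<n_i} u^j) · |T|`. (Both tails of the binomial count bounded by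
the generating function `Σ_k u^{±(Σ k_i - threshold)} `, threshold `⌈Σ_i (n_i-1)/3⌉`.) [this work] -/
theorem binomialCoprime_twistedMatching_card_le_effective (p : ℕ) [hp : Fact p.Prime] {κ : Type}
    [Fintype κ] [DecidableEq κ] (n e : κ → ℕ) [∀ i, NeZero (n i)] (hn : ∀ i, n i = p ^ e i)
    (T : Type) [Group T] [Fintype T] [DecidableEq T] (hT : Nat.Coprime p (Fintype.card T))
    (S : Type) [Group S] (eS : S ≃* (((i : κ) → Multiplicative (ZMod (n i))) × T))
    (σ : Type) [Fintype σ] (φ ψ : σ → S ≃* S) (ι : Type) [Fintype ι] (x y z : ι → S)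
    (hmatch : ∀ i j l : ι, (∃ s : σ, x i * φ s (y j) * ψ s (z l) = 1) ↔ (i = j ∧ j = l))
    (u : ℝ) (hu0 : 0 < u) (hu1 : u ≤ 1) :
    (Fintype.card ι : ℝ) ≤ 3 * (∏ i, (u ^ (-(((n i - 1 : ℕ) : ℝ) / 3)) *
      ∑ j : Fin (n i), u ^ ((j : ℕ) : ℝ))) * Fintype.card T := by
  classical
  -- total degree `D = Σ (n_i - 1)`, threshold `tt = ⌈D/3⌉`
  set D : ℕ := ∑ i, (n i - 1) with hD
  set tt : ℕ := (D + 2) / 3 with htt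
  have hcard := binomialCoprime_twistedMatching_card_le p n e hn T hT S eS σ φ ψ ι x y z hmatch
    tt tt
  have hcard' : (Fintype.card ι : ℝ) ≤
      ((Fintype.card {k : (i : κ) → Fin (n i) // ∑ i, (k i : ℕ) < tt} : ℝ) +
        (Fintype.card {k : (i : κ) → Fin (n i) // ∑ i, (k i : ℕ) < tt} : ℝ) +
        (Fintype.card {k : (i : κ) → Fin (n i) // tt + tt ≤ ∑ i, (k i : ℕ)} : ℝ)) *
        (Fintype.card T : ℝ) := by
    exact_mod_cast hcard
  have hdegle : ∀ k : (i : κ) → Fin (n i), ∑ i, (k i : ℕ) ≤ D := fun k =>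
    Finset.sum_le_sum fun i _ => by have := (k i).2; omega
  -- the per-coordinate factor
  let F : κ → ℝ := fun i => u ^ (-(((n i - 1 : ℕ) : ℝ) / 3)) * ∑ j : Fin (n i), u ^ ((j : ℕ) : ℝ)
  have hDr : (D : ℝ) = ∑ i, ((n i - 1 : ℕ) : ℝ) := by rw [hD, Nat.cast_sum]
  have hprodF : ∏ i, F i = u ^ (-((D : ℝ) / 3)) * ∏ i, ∑ j : Fin (n i), u ^ ((j : ℕ) : ℝ) := by
    simp only [F]
    rw [Finset.prod_mul_distrib, ← Real.rpow_sum_of_pos hu0]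
    congr 2
    rw [hDr, Finset.sum_div, ← Finset.sum_neg_distrib]
  -- lower tail
  have hlow : (Fintype.card {k : (i : κ) → Fin (n i) // ∑ i, (k i : ℕ) < tt} : ℝ) ≤ ∏ i, F i := by
    have h1 := card_subtype_le_sum_rpow (fun k : (i : κ) → Fin (n i) => ∑ i, (k i : ℕ) < tt)
      u hu0 (fun k => -((D : ℝ) / 3) + 1 * ∑ i, ((k i : ℕ) : ℝ)) (fun k hk => by
        refine Real.one_le_rpow_of_pos_of_le_one_of_nonpos hu0 hu1 ?_
        have h3 : 3 * ∑ i, (k i : ℕ) ≤ D := by omega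
        have h4 : (3 : ℝ) * ∑ i, ((k i : ℕ) : ℝ) ≤ D := by exact_mod_cast h3
        linarith)
    refine h1.trans (le_of_eq ?_)
    rw [sum_rpow_pi n u hu0, hprodF]
    simp only [one_mul]
  -- upper tail
  have hhigh : (Fintype.card {k : (i : κ) → Fin (n i) // tt + tt ≤ ∑ i, (k i : ℕ)} : ℝ) ≤
      ∏ i, F i := by
    have h1 := card_subtype_le_sum_rpow
      (fun k : (i : κ) → Fin (n i) => tt + tt ≤ ∑ i, (k i : ℕ))
      u hu0 (fun k => 2 * (D : ℝ) / 3 + (-1) * ∑ i, ((k i : ℕ) : ℝ)) (fun k hk => by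
        refine Real.one_le_rpow_of_pos_of_le_one_of_nonpos hu0 hu1 ?_
        have h3 : 2 * D ≤ 3 * ∑ i, (k i : ℕ) := by omega
        have h4 : (2 : ℝ) * D ≤ 3 * ∑ i, ((k i : ℕ) : ℝ) := by exact_mod_cast h3
        linarith)
    refine h1.trans (le_of_eq ?_)
    rw [sum_rpow_pi n u hu0]
    have h2 : ∀ i, ∑ j : Fin (n i), u ^ (-1 * ((j : ℕ) : ℝ)) =
        u ^ (-(((n i - 1 : ℕ) : ℝ))) * ∑ j : Fin (n i), u ^ ((j : ℕ) : ℝ) :=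
      fun i => sum_rpow_neg_eq (n i) u hu0
    simp_rw [h2]
    rw [Finset.prod_mul_distrib, ← Real.rpow_sum_of_pos hu0, ← mul_assoc, ← Real.rpow_add hu0,
      hprodF]
    congr 2
    rw [hDr, Finset.sum_neg_distrib]
    ring
  show (Fintype.card ι : ℝ) ≤ 3 * (∏ i, F i) * Fintype.card T
  calc (Fintype.card ι : ℝ) ≤ _ := hcard'
    _ ≤ ((∏ i, F i) + (∏ i, F i) + ∏ i, F i) * (Fintype.card T : ℝ) := by gcongr
    _ = 3 * (∏ i, F i) * Fintype.card T := by ring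

/-- **Theorem B‴ (effective form).** `S ≅ ∏_i ℤ/n_i`, `n_i = p^{e_i}`, any automorphism-pair twists,
any twisted matching, any `0 < u ≤ 1`: `|ι| ≤ 3 ∏_i θ_{n_i}(u)`, `θ_q(u) = u^{-(q-1)/3} Σ_{j<q} u^j`.
For `n_i = p` this is `twistedMatching_card_le_effective` (Ellenberg–Gijswijt constant); for
`q = 4, 8, 9` the infima `4^{0.9262}`, `8^{0.9359}`, `9^{0.9376}` are the untwisted slice-rank
constants of `ℤ/q` (BCCGNSU 2017 §4, Petrov 2016). [this work] -/
theorem binomial_twistedMatching_card_le_effective (p : ℕ) [Fact p.Prime] {κ : Type} [Fintype κ]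
    [DecidableEq κ] (n e : κ → ℕ) [∀ i, NeZero (n i)] (hn : ∀ i, n i = p ^ e i)
    (S : Type) [Group S] (eS : S ≃* ((i : κ) → Multiplicative (ZMod (n i))))
    (σ : Type) [Fintype σ] (φ ψ : σ → S ≃* S) (ι : Type) [Fintype ι] (x y z : ι → S)
    (hmatch : ∀ i j l : ι, (∃ s : σ, x i * φ s (y j) * ψ s (z l) = 1) ↔ (i = j ∧ j = l))
    (u : ℝ) (hu0 : 0 < u) (hu1 : u ≤ 1) :
    (Fintype.card ι : ℝ) ≤ 3 * ∏ i, (u ^ (-(((n i - 1 : ℕ) : ℝ) / 3)) *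
      ∑ j : Fin (n i), u ^ ((j : ℕ) : ℝ)) := by
  have h := binomialCoprime_twistedMatching_card_le_effective p n e hn Unit
    (by rw [Fintype.card_unit]; exact Nat.coprime_one_right p) S
    (eS.trans (MulEquiv.prodUnique : (((i : κ) → Multiplicative (ZMod (n i))) × Unit) ≃* _).symm)
    σ φ ψ ι x y z hmatch u hu0 hu1
  simpa only [Fintype.card_unit, Nat.cast_one, mul_one] using h

/-- **Theorem B‴, `|S|^c` form.** If `θ_{n_i}(u) ≤ n_i^c` for every `i`, then twisted matchings in
`S ≅ ∏_i ℤ/n_i` (`n_i = p^{e_i}`) have `|ι| ≤ 3 |S|^c`, for all automorphism-pair twists.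
[this work] -/
theorem binomial_twistedMatching_card_le_rpow (p : ℕ) [Fact p.Prime] {κ : Type} [Fintype κ]
    [DecidableEq κ] (n e : κ → ℕ) [∀ i, NeZero (n i)] (hn : ∀ i, n i = p ^ e i) (u c : ℝ)
    (hu0 : 0 < u) (hu1 : u ≤ 1)
    (hθ : ∀ i, u ^ (-(((n i - 1 : ℕ) : ℝ) / 3)) * ∑ j : Fin (n i), u ^ ((j : ℕ) : ℝ) ≤
      ((n i : ℕ) : ℝ) ^ c)
    (S : Type) [Group S] [Fintype S] (eS : S ≃* ((i : κ) → Multiplicative (ZMod (n i))))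
    (σ : Type) [Fintype σ] (φ ψ : σ → S ≃* S) (ι : Type) [Fintype ι] (x y z : ι → S)
    (hmatch : ∀ i j l : ι, (∃ s : σ, x i * φ s (y j) * ψ s (z l) = 1) ↔ (i = j ∧ j = l)) :
    (Fintype.card ι : ℝ) ≤ 3 * (Fintype.card S : ℝ) ^ c := by
  classical
  have h := binomial_twistedMatching_card_le_effective p n e hn S eS σ φ ψ ι x y z hmatch u hu0 hu1
  have hF0 : ∀ i, 0 ≤ u ^ (-(((n i - 1 : ℕ) : ℝ) / 3)) * ∑ j : Fin (n i), u ^ ((j : ℕ) : ℝ) :=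
    fun i => mul_nonneg (Real.rpow_nonneg hu0.le _)
      (Finset.sum_nonneg fun j _ => Real.rpow_nonneg hu0.le _)
  have hS : (Fintype.card S : ℝ) = ∏ i, ((n i : ℕ) : ℝ) := by
    rw [Fintype.card_congr eS.toEquiv, Fintype.card_pi, Nat.cast_prod]
    exact Finset.prod_congr rfl fun i _ => by rw [Fintype.card_multiplicative, ZMod.card]
  have hprod : ∏ i, (u ^ (-(((n i - 1 : ℕ) : ℝ) / 3)) * ∑ j : Fin (n i), u ^ ((j : ℕ) : ℝ)) ≤
      (Fintype.card S : ℝ) ^ c := by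
    rw [hS, ← Real.finsetProd_rpow _ _ (fun i _ => Nat.cast_nonneg _)]
    exact Finset.prod_le_prod (fun i _ => hF0 i) fun i _ => hθ i
  linarith

/-- **Theorem B‴, `|T| |A|^c` form (coprime splitting).** If `θ_{n_i}(u) ≤ n_i^c` for every `i`,
then twisted matchings in `S ≅ A × T`, `A = ∏_i ℤ/n_i` (`n_i = p^{e_i}`), `p ∤ |T|`, have
`|ι| ≤ 3 |T| |A|^c`, for all automorphism-pair twists. [this work] -/
theorem binomialCoprime_twistedMatching_card_le_rpow (p : ℕ) [Fact p.Prime] {κ : Type}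
    [Fintype κ] [DecidableEq κ] (n e : κ → ℕ) [∀ i, NeZero (n i)] (hn : ∀ i, n i = p ^ e i)
    (u c : ℝ) (hu0 : 0 < u) (hu1 : u ≤ 1)
    (hθ : ∀ i, u ^ (-(((n i - 1 : ℕ) : ℝ) / 3)) * ∑ j : Fin (n i), u ^ ((j : ℕ) : ℝ) ≤
      ((n i : ℕ) : ℝ) ^ c)
    (T : Type) [Group T] [Fintype T] [DecidableEq T] (hT : Nat.Coprime p (Fintype.card T))
    (S : Type) [Group S] (eS : S ≃* (((i : κ) → Multiplicative (ZMod (n i))) × T))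
    (σ : Type) [Fintype σ] (φ ψ : σ → S ≃* S) (ι : Type) [Fintype ι] (x y z : ι → S)
    (hmatch : ∀ i j l : ι, (∃ s : σ, x i * φ s (y j) * ψ s (z l) = 1) ↔ (i = j ∧ j = l)) :
    (Fintype.card ι : ℝ) ≤ 3 * (Fintype.card T : ℝ) *
      (Fintype.card ((i : κ) → Multiplicative (ZMod (n i))) : ℝ) ^ c := by
  classical
  have h := binomialCoprime_twistedMatching_card_le_effective p n e hn T hT S eS σ φ ψ ι x y z
    hmatch u hu0 hu1
  have hF0 : ∀ i, 0 ≤ u ^ (-(((n i - 1 : ℕ) : ℝ) / 3)) * ∑ j : Fin (n i), u ^ ((j : ℕ) : ℝ) :=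
    fun i => mul_nonneg (Real.rpow_nonneg hu0.le _)
      (Finset.sum_nonneg fun j _ => Real.rpow_nonneg hu0.le _)
  have hA : (Fintype.card ((i : κ) → Multiplicative (ZMod (n i))) : ℝ) = ∏ i, ((n i : ℕ) : ℝ) := by
    rw [Fintype.card_pi, Nat.cast_prod]
    exact Finset.prod_congr rfl fun i _ => by rw [Fintype.card_multiplicative, ZMod.card]
  have hprod : ∏ i, (u ^ (-(((n i - 1 : ℕ) : ℝ) / 3)) * ∑ j : Fin (n i), u ^ ((j : ℕ) : ℝ)) ≤
      (Fintype.card ((i : κ) → Multiplicative (ZMod (n i))) : ℝ) ^ c := by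
    rw [hA, ← Real.finsetProd_rpow _ _ (fun i _ => Nat.cast_nonneg _)]
    exact Finset.prod_le_prod (fun i _ => hF0 i) fun i _ => hθ i
  have hT0 : (0 : ℝ) ≤ Fintype.card T := Nat.cast_nonneg _
  calc (Fintype.card ι : ℝ) ≤ _ := h
    _ ≤ 3 * (Fintype.card ((i : κ) → Multiplicative (ZMod (n i))) : ℝ) ^ c * Fintype.card T := by
        gcongr
    _ = _ := by ring

end Binomial

end Summit.MatrixMultiplication.MatrixMultiplication.Theorems.TwistedSliceRank
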